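import Literature.Analysis.FluidPDE.GaussianVortexPlanar
import Literature.Analysis.FluidPDE.AsymBurgersLinearizedEvenInvertibility

/-!
# Crux `CoreLinearInvertibility` (stmt-NavierStokesRegularity-17973), line `Sketch`, stub
# `stub_coreBoundEven`: the even sector is Maekawa's theorem (M3AS 19 (2009), Lemma 4.1)

The registered stub `stub_coreBoundEven` asks, for every asymmetry `λ ∈ [0,1)`, for a uniform-in-`R`
a-priori bound `c² ‖w‖²_{X_λ} ≤ ‖T_{λ,R} w‖²_{X_λ}`, `R ≥ R₀(λ)`, on EVEN (`w(−x) = w(x)`),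
mass-zero, compactly supported `C²` vorticities, where
`T_{λ,R} w = L_λ w − R (v^G·∇w + (K_{2D}∗w)·∇G)` and `X_λ = L²(G_λ⁻¹ dx)`.

This is IN PRINT: Y. Maekawa, *Existence of asymmetric Burgers vortices and their asymptotic
behavior at large circulations*, Math. Models Methods Appl. Sci. **19** (2009) 669–705, §4,
Lemma 4.1 (estimate (4.1)) — for every `λ ∈ [0,1)` there is `Θ(λ) ≥ 0` such that for `|α| ≥ Θ(λ)`
the operator `L_{λ,α} = L + λM − αΛ` (his (1.25); `L + λM = L_λ` of the survey, `Λ = Λ_G`) has a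
bounded inverse on `𝒫ᵉ X_λ` (`X_λ` = `L²(G_λ⁻¹dx)` WITH the zero-mass condition, his (1.10);
`𝒫ᵉ = ⊕ₙ 𝒫₂ₙ` = functions even under `x ↦ −x`), with `‖L_{λ,α}⁻¹ f‖_{Y_λ ∩ W_λ}` bounded by
`‖f‖_{X_λ}` uniformly in `|α| ≥ Θ(λ)` (constants `J₁, J₂` independent of `α`, `δ₁, δ₂` bounded and
`→ 0`); restated in Th. Gallay, Y. Maekawa, arXiv:1610.08384, §4.1, (4.9) and p. 18 ("the
invertibility of `L_λ − αΛ_G` in `𝒫ᵉ L²₀(∞;λ)` ... uniform estimates on the inverse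
`(L_λ − αΛ_G)⁻¹`"). We vendor it INLINE as the named fact `Maekawa2009_evenSectorInverseBound`
(a `def … : Prop`, relocated by the gate to `Literature/Analysis/FluidPDE/AsymBurgersLinearizedEvenInvertibility`), in the
a-priori form restricted to `C²_c ∩ 𝒫ᵉ X_λ` (a transparent specialisation: `C²_c ⊂ D(L_{λ,α})`,
where all his operators act classically, and `w = L_{λ,α}⁻¹(L_{λ,α} w)` by injectivity), and prove
the reduction `stub_coreBoundEvenOfMaekawa2009 : Literature.Analysis.FluidPDE.Maekawa2009_evenSectorInverseBound → <stub body>`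
(`R₀ = |Θ|`, `c = C⁻¹`; a registered tools stub of the crux). Reviewer notes (what the paper prints,
verbatim prose with locators; the held copy is s2orc text with displays stripped, PDF requested as
acq-07325): `Cruxes/CoreLinearInvertibility/CoreBoundEven-MAEKAWA.md` in the crux workfile directory.

## References

* Y. Maekawa, *Existence of asymmetric Burgers vortices and their asymptotic behavior at large
  circulations*, Math. Models Methods Appl. Sci. 19 (2009) 669–705, doi:10.1142/S0218202509003577,
  §1 (1.9)–(1.16), (1.23)–(1.25), (1.30), Lemma 1.1; §4 Lemma 4.1 (4.1)–(4.3), Lemma 4.2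
  (4.9)–(4.12). [Maekawa2009b] (`Maekawa2009` is the JMAA paper)
* Th. Gallay, Y. Maekawa, *Existence and stability of viscous vortices*, arXiv:1610.08384, §4.1
  (4.5)–(4.9), Thm. 4.2, p. 18. [GallayMaekawa2016]
* Y. Maekawa, *On the existence of Burgers vortices for high Reynolds numbers*, J. Math. Anal. Appl.
  349 (2009) 181–200, (1.9)–(1.11), Lemma 3.1 (the `λ < ½` model in `X = L²₀(G⁻¹)`). [Maekawa2009]
-/

set_option linter.dupNamespace false

noncomputable section

namespace Summit.NavierStokesRegularity.NavierStokesRegularity.Theorems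

open Set Function Filter MeasureTheory Topology
open Literature.Analysis.FluidPDE
open scoped InnerProductSpace Laplacian ContDiff

/-- **Reduction (range check): the even-sector stub from Maekawa's Lemma 4.1.** With
`R₀ = |Θ(λ)|` and `c = C(λ)⁻¹`, every `R ≥ R₀` has `|R| ≥ Θ(λ)`, and the vendored a-priori bound
`‖w‖² ≤ C² ‖T_{λ,R} w‖²` on compactly supported `C²` even mass-zero `w` is `c² ‖w‖² ≤ ‖T_{λ,R} w‖²`.
The conclusion is VERBATIM the body of the registered stub `stub_coreBoundEven` of the skeleton
`Cruxes/CoreLinearInvertibility/Lines/Sketch.lean`; this implication is itself the registered tools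
stub `stub_coreBoundEvenOfMaekawa2009` (crux stmt-NavierStokesRegularity-17973, line `Sketch`). -/
theorem stub_coreBoundEvenOfMaekawa2009 : Literature.Analysis.FluidPDE.Maekawa2009_evenSectorInverseBound →
    (∀ lam ∈ Set.Ico (0 : ℝ) 1, ∃ R₀ c : ℝ, 0 < c ∧ ∀ R : ℝ, R₀ ≤ R →
    ∀ w : EuclideanSpace ℝ (Fin 2) → ℝ, ContDiff ℝ 2 w → HasCompactSupport w →
    (∀ x, w (-x) = w x) → ∫ x, w x = 0 →
    c ^ 2 * ∫ x, (gaussWeightLam lam x)⁻¹ * w x ^ 2 ≤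
      ∫ x, (gaussWeightLam lam x)⁻¹ * (strainedVorticityOperator lam w x -
        R * (⟪gaussVortexVelocity x, gradient w x⟫_ℝ +
          ⟪biotSavart2D w x, gradient gaussVortexProfile x⟫_ℝ)) ^ 2) := by
  intro hM lam hlam
  obtain ⟨Θ, C, hC, h⟩ := hM lam hlam
  refine ⟨|Θ|, C⁻¹, inv_pos.2 hC, fun R hR w hw hws heven hmass => ?_⟩
  have hα : Θ ≤ |R| := (le_abs_self Θ).trans (hR.trans (le_abs_self R))
  have hb := h R hα w hw hws heven hmass
  have hCne : C ≠ 0 := hC.ne'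
  calc C⁻¹ ^ 2 * ∫ x, (gaussWeightLam lam x)⁻¹ * w x ^ 2
      ≤ C⁻¹ ^ 2 * (C ^ 2 * ∫ x, (gaussWeightLam lam x)⁻¹ * (strainedVorticityOperator lam w x -
          R * (⟪gaussVortexVelocity x, gradient w x⟫_ℝ +
            ⟪biotSavart2D w x, gradient gaussVortexProfile x⟫_ℝ)) ^ 2) :=
        mul_le_mul_of_nonneg_left hb (sq_nonneg _)
    _ = ∫ x, (gaussWeightLam lam x)⁻¹ * (strainedVorticityOperator lam w x -
          R * (⟪gaussVortexVelocity x, gradient w x⟫_ℝ +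
            ⟪biotSavart2D w x, gradient gaussVortexProfile x⟫_ℝ)) ^ 2 := by
        rw [← mul_assoc, inv_pow, inv_mul_cancel₀ (pow_ne_zero 2 hCne), one_mul]

end Summit.NavierStokesRegularity.NavierStokesRegularity.Theorems
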